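import Summits.QuantumFields.BalabanUV.Beta.ChartConjugation
import Literature.MathematicalPhysics.QuantumFieldTheory.Balaban1983to89.Beta.ResolventReflection

/-!
# `BalabanUV.Beta.ChartConjugationReflection` — the reflection law of a resolvent Hessian whose vertex families obey the CONJUGATED
# laws (Sr-conj)/(Wr-conj), and the transport of the contact through the chain-rule vertex (β sub-cell, row BETA-an5, gen 18;
# file 3 of 4 of the chart-conjugation leaf; item (iii′) of X-an2-40 §5 / β-lead RULING (R33-A-2′))

HONEST FRAMING (cell contract, verbatim): «discharging `BetaPertH` makes Bałaban's UV stability UNCONDITIONAL — a real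
constructive-QFT result; it is NOT the continuum limit and NOT the Clay problem.»  THIS MODULE is elementary analysis on matrix-fibred
lattice kernels: it formalises NO statement printed in Bałaban's papers, cites none as a hypothesis, mints no `Prop` fact and no `def`,
instantiates NO binder of the wall and DISCHARGES NOTHING of it.  NOT summit progress.

ABSOLUTE RULE (cell, verbatim): «No internally-minted statement may enter as a cited fact. Every hypothesis is either
kernel-proved in this package or a verbatim quotation of a PUBLISHED theorem with page reference. The manuscript(s) under
audit are NOT citable for their own disputed steps — they are the thing under adjudication; programme-internal
(2001/route/tribunal) claims are never citable.»  Every theorem below is kernel-proved from explicit, abstract hypotheses.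

PLACEMENT.  Cell topic `Summits/QuantumFields/BalabanUV/Beta/` (RULINGS (R34-A), (R33-A-2′)); imports the sibling `ChartConjugation` and
the tree leaf `Literature/…/Beta/ResolventReflection`; imported only by the sibling `ChartConjugationEnd`, by nothing under `Literature/`.

CONTENT.  §1 **`hess_refl_conj`** = `KernelReflection.hess_refl` with
the CONJUGATED vertex laws `V μ (ρ μ y) = σ μ • refK Φ (V μ y + conjV 𝕄 (X μ y))`, `W μ (ρ μ y) ν (ρ ν y′) = (σ μ σ ν) • refK Φ (W μ y ν y′ +
conjW 𝕄 …)` (contacts on the SOURCE side inside `refK`; proof: transport as in the tree, then `ChartConjugation.hess_conj_invariant`),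
`hessKer_refl_conj`, **`axisReflectionCovariant_flip_hessKer_conj`**; §2 exchange lemmas `comp_wsum` / `wsum_comp`
(`KernelWard.tsum_comm_of_prodBound`), `wsum_add/sub`; §3 the packed level: `vertexOfK_add/neg`, `trK_vertexOfK`, `loc_wsum_colH`,
**`vertexOfK_conjV`** (`vertexOfK K N (conjV 𝕄 ∘ C) = conjV 𝕄 (vertexOfK K N C)`), `vertexOfK_reflect'` (the tree's `vertexOfK_reflect` with an
arbitrary family on the right, same proof) and **`vertexOfK_reflect_conj`**: the FINE socket (Sr-conj) gives the COARSE conjugated vertex law.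
NOT continuum, NOT Clay.
-/

open Finset
open scoped BigOperators
open Literature.MathematicalPhysics.QuantumFieldTheory.Balaban1983to89
open Literature.MathematicalPhysics.QuantumFieldTheory.Balaban1983to89.Beta
open B12Sec2to5 (l1 l1_nonneg)
open ExpKernelCalculus (MKer Decays BiLoc comp tr bubble tadpole hess hessKer hess_eq_hessKer BlockCovariant VertexFamily VertexFamily₂
  summable_exp_shift summable_exp_shift' biLoc_comp_decays)
open PolarizationSign (axisReflect axisReflect_apply reflSign AxisReflectionCovariant)
open KernelReflection (LegMap refK refK_apply bondRefl bondRefl_sub comp_refK tr_refK summable_trSlice tadpole_smul bubble_smul_left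
  bubble_smul_right)
open KernelWard (bdd_of_biLoc bdd_of_decays tsum_comm_of_prodBound comp_finset_sum_right comp_finset_sum_left)
open HessKerSchurResolvent (idK)
open OneStepResolventKernel (Fib wsum biLoc_wsum LocStencil JetData)
open OneStepKernelFamily (KInvStep decays_KInvStep shiftK_KInvStep colH abs_colH_le vertexOfK vertexFamily_vertexOfK' TstepOf TbalOf
  flipK)
open ResolventReflection (bref bref_bref bref_eq_bondRefl Φ Φ_s_inl Φ_s_inr Φ_r_inl Φ_r_inr colH_reflect reflSign_mul_self refK_KInvStep
  vertexOfK_translate_block)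
open Summit.QuantumFields.BalabanUV.Beta.TameKernelCalculus
open Summit.QuantumFields.BalabanUV.Beta.ChartConjugation

namespace Summit.QuantumFields.BalabanUV.Beta.ChartConjugationReflection

noncomputable section

section General

variable {D : ℕ} {F : Type*} [Fintype F]

/-! ## §1 Covariance of the resolvent Hessian under a symmetry with CONJUGATED vertex laws -/

/-- **COVARIANCE OF THE RESOLVENT HESSIAN, CONJUGATED VERTEX LAWS** (`KernelReflection.hess_refl` twin).  If the resolvent `A` is
relabelling-invariant, has a spread two-sided inverse `𝕄`, and the vertex families at the image bonds are the relabelled ones PLUS the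
chart-conjugation contacts `conjV 𝕄 (X μ y)` / `conjW 𝕄 (V μ y) (V ν y′) (X μ y) (X ν y′) (X₂ μ y ν y′)` (all inside `refK`, source side), up
to the bond signs `σ`, then `hess μ (ρ μ y) ν (ρ ν y′) = σ μ σ ν · hess μ y ν y′` — exactly as without contacts. -/
theorem hess_refl_conj [DecidableEq F] (Φ : LegMap D F) {A M : MKer D F} {V : Fin D → (Fin D → ℤ) → MKer D F}
    {W : Fin D → (Fin D → ℤ) → Fin D → (Fin D → ℤ) → MKer D F} (hA : Spr A) (hM : Spr M) (hAM : comp A M = idK)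
    (hMA : comp M A = idK) (hAr : refK Φ A = A) (hV : ∀ μ y, Loc (V μ y)) (hW : ∀ μ y ν y', Loc (W μ y ν y'))
    (ρ : Fin D → (Fin D → ℤ) → (Fin D → ℤ)) (σ : Fin D → ℝ) {X : Fin D → (Fin D → ℤ) → MKer D F}
    {X₂ : Fin D → (Fin D → ℤ) → Fin D → (Fin D → ℤ) → MKer D F} (hX : ∀ μ y, Loc (X μ y)) (hX₂ : ∀ μ y ν y', Loc (X₂ μ y ν y'))
    (hVr : ∀ μ y, V μ (ρ μ y) = σ μ • refK Φ (V μ y + conjV M (X μ y)))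
    (hWr : ∀ μ y ν y', W μ (ρ μ y) ν (ρ ν y') =
      (σ μ * σ ν) • refK Φ (W μ y ν y' + conjW M (V μ y) (V ν y') (X μ y) (X ν y') (X₂ μ y ν y')))
    (μ : Fin D) (y : Fin D → ℤ) (ν : Fin D) (y' : Fin D → ℤ) :
    hess A V W μ (ρ μ y) ν (ρ ν y') = σ μ * σ ν * hess A V W μ y ν y' := by
  have key := hess_conj_invariant hA hM hAM hMA (hV μ y) (hV ν y') (hW μ y ν y') (hX μ y) (hX ν y') (hX₂ μ y ν y')
  have hW' : Loc (W μ y ν y' + conjW M (V μ y) (V ν y') (X μ y) (X ν y') (X₂ μ y ν y')) :=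
    (hW μ y ν y').add (loc_conjW hM (hV μ y) (hV ν y') (hX μ y) (hX ν y') (hX₂ μ y ν y'))
  have hV₁ : Loc (V μ y + conjV M (X μ y)) := (hV μ y).add (loc_conjV hM (hX μ y))
  have hV₂ : Loc (V ν y' + conjV M (X ν y')) := (hV ν y').add (loc_conjV hM (hX ν y'))
  unfold ExpKernelCalculus.hess
  rw [hWr, hVr, hVr, tadpole_smul, bubble_smul_left, bubble_smul_right]
  conv_lhs => rw [← hAr]
  rw [tadpole_refK_loc Φ hA hW', bubble_refK_loc Φ hA hV₁ hV₂]
  linear_combination (σ μ * σ ν) * key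

open B6BondElimination (unitVec unitVec_apply) in
/-- **THE DIFFERENCE-VARIABLE LAW, CONJUGATED VERTEX LAWS** (`KernelReflection.hessKer_refl` twin). -/
theorem hessKer_refl_conj [DecidableEq F] (Φ : LegMap D F) {A M : MKer D F} {V : Fin D → (Fin D → ℤ) → MKer D F}
    {W : Fin D → (Fin D → ℤ) → Fin D → (Fin D → ℤ) → MKer D F} {N : ℕ} (hA : Spr A) (hM : Spr M) (hAM : comp A M = idK)
    (hMA : comp M A = idK) (hcov : BlockCovariant A V W N) (hAr : refK Φ A = A) (hV : ∀ μ y, Loc (V μ y))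
    (hW : ∀ μ y ν y', Loc (W μ y ν y')) (α : Fin D) (c : ℤ) {X : Fin D → (Fin D → ℤ) → MKer D F}
    {X₂ : Fin D → (Fin D → ℤ) → Fin D → (Fin D → ℤ) → MKer D F} (hX : ∀ μ y, Loc (X μ y)) (hX₂ : ∀ μ y ν y', Loc (X₂ μ y ν y'))
    (hVr : ∀ μ y, V μ (bondRefl α c μ y) = reflSign α μ • refK Φ (V μ y + conjV M (X μ y)))
    (hWr : ∀ μ y ν y', W μ (bondRefl α c μ y) ν (bondRefl α c ν y') =
      (reflSign α μ * reflSign α ν) • refK Φ (W μ y ν y' + conjW M (V μ y) (V ν y') (X μ y) (X ν y') (X₂ μ y ν y')))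
    (μ ν : Fin D) (z : Fin D → ℤ) :
    hessKer A V W μ ν (axisReflect α z + (if μ = α then unitVec α else 0) - (if ν = α then unitVec α else 0))
      = reflSign α μ * reflSign α ν * hessKer A V W μ ν z := by
  have h := hess_refl_conj Φ hA hM hAM hMA hAr hV hW (bondRefl α c) (reflSign α) hX hX₂ hVr hWr μ 0 ν z
  rw [hess_eq_hessKer hcov, hess_eq_hessKer hcov, sub_zero, bondRefl_sub, sub_zero] at h
  exact h

open B6BondElimination (unitVec unitVec_apply) in
/-- **`AxisReflectionCovariant` OF THE FLIPPED KERNEL FROM THE CONJUGATED VERTEX LAWS** (`KernelReflection.axisReflectionCovariant_flip_hessKer`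
twin): per axis, a leg map fixing `A`, an offset, and localised contact families `X`, `X₂` with (Sr-conj)/(Wr-conj). -/
theorem axisReflectionCovariant_flip_hessKer_conj [DecidableEq F] {A M : MKer D F} {V : Fin D → (Fin D → ℤ) → MKer D F}
    {W : Fin D → (Fin D → ℤ) → Fin D → (Fin D → ℤ) → MKer D F} {N : ℕ} (hA : Spr A) (hM : Spr M) (hAM : comp A M = idK)
    (hMA : comp M A = idK) (hcov : BlockCovariant A V W N) (hV : ∀ μ y, Loc (V μ y)) (hW : ∀ μ y ν y', Loc (W μ y ν y'))
    (hAr : ∀ α : Fin D, ∃ Φα : LegMap D F, refK Φα A = A ∧ ∃ (c : ℤ) (X : Fin D → (Fin D → ℤ) → MKer D F)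
      (X₂ : Fin D → (Fin D → ℤ) → Fin D → (Fin D → ℤ) → MKer D F), (∀ μ y, Loc (X μ y)) ∧ (∀ μ y ν y', Loc (X₂ μ y ν y')) ∧
      (∀ μ y, V μ (bondRefl α c μ y) = reflSign α μ • refK Φα (V μ y + conjV M (X μ y))) ∧
      (∀ μ y ν y', W μ (bondRefl α c μ y) ν (bondRefl α c ν y') =
        (reflSign α μ * reflSign α ν) • refK Φα (W μ y ν y' + conjW M (V μ y) (V ν y') (X μ y) (X ν y') (X₂ μ y ν y')))) :
    AxisReflectionCovariant (fun μ ν z => hessKer A V W μ ν (-z)) := by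
  intro α μ ν z
  obtain ⟨Φα, hA', c, X, X₂, hX, hX₂, hVr, hWr⟩ := hAr α
  have h := hessKer_refl_conj Φα hA hM hAM hMA hcov hA' hV hW α c hX hX₂ hVr hWr μ ν (-z)
  have e : -(axisReflect α z - (if μ = α then unitVec α else 0) + (if ν = α then unitVec α else 0))
      = axisReflect α (-z) + (if μ = α then unitVec α else 0) - (if ν = α then unitVec α else 0) := by
    funext i
    simp only [Pi.neg_apply, Pi.sub_apply, Pi.add_apply, axisReflect_apply]
    by_cases hi : i = α <;> by_cases hμ : μ = α <;> by_cases hν : ν = α <;> simp [hi, hμ, hν, unitVec_apply] <;> ring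
  show hessKer A V W μ ν (-(axisReflect α z - (if μ = α then unitVec α else 0) + (if ν = α then unitVec α else 0)))
    = reflSign α μ * reflSign α ν * hessKer A V W μ ν (-z)
  rw [e]
  exact h

/-! ## §2 Exchange lemmas for weighted superpositions -/

/-- EXCHANGE `𝕄 ∘ (Σ'_u w_u C_u) = Σ'_u w_u (𝕄 ∘ C_u)` for spread `𝕄`, absolutely summable weights and a uniformly bounded family. -/
theorem comp_wsum {M : MKer D F} {w : (Fin D → ℤ) → ℝ} {Cf : (Fin D → ℤ) → MKer D F} (hM : Spr M)
    (hw : Summable fun u => |w u|) {B : ℝ} (hB0 : 0 ≤ B) (hB : ∀ u x z a b, |Cf u x z a b| ≤ B) :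
    comp M (wsum w Cf) = wsum w (fun u => comp M (Cf u)) := by
  obtain ⟨CM, δ, hδ, hMd⟩ := hM
  funext x z a b
  simp only [ExpKernelCalculus.comp, OneStepResolventKernel.wsum]
  have hs : ∀ y f, Summable fun u => M x y a f * (w u * Cf u y z f b) := fun y f => by
    refine Summable.of_norm_bounded ((hw.mul_left (|M x y a f| * B))) (fun u => ?_)
    rw [Real.norm_eq_abs, abs_mul, abs_mul]
    calc |M x y a f| * (|w u| * |Cf u y z f b|) ≤ |M x y a f| * (|w u| * B) :=
          mul_le_mul_of_nonneg_left (mul_le_mul_of_nonneg_left (hB u y z f b) (abs_nonneg _)) (abs_nonneg _)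
      _ = |M x y a f| * B * |w u| := by ring
  have step1 : (fun y => ∑ f, M x y a f * ∑' u, w u * Cf u y z f b) = fun y => ∑' u, ∑ f, M x y a f * (w u * Cf u y z f b) := by
    funext y
    rw [Summable.tsum_finsetSum (fun f _ => hs y f)]
    exact Finset.sum_congr rfl fun f _ => tsum_mul_left.symm
  have hPB : KernelWard.ProdBound (fun y u => ∑ f, M x y a f * (w u * Cf u y z f b)) := by
    refine ⟨fun y => ((Fintype.card F : ℝ) * |CM| * B) * Real.exp (-δ * l1 (x - y)), fun u => |w u|,
      (summable_exp_shift hδ x).mul_left _, hw, fun y => by positivity, fun u => abs_nonneg _, fun y u => ?_⟩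
    calc |∑ f, M x y a f * (w u * Cf u y z f b)| ≤ ∑ f, |M x y a f * (w u * Cf u y z f b)| := Finset.abs_sum_le_sum_abs _ _
      _ ≤ ∑ _f : F, |CM| * Real.exp (-δ * l1 (x - y)) * B * |w u| := Finset.sum_le_sum fun f _ => by
          rw [abs_mul, abs_mul]
          have h1 : |M x y a f| ≤ |CM| * Real.exp (-δ * l1 (x - y)) :=
            (hMd x y a f).trans (mul_le_mul_of_nonneg_right (le_abs_self _) (Real.exp_pos _).le)
          calc |M x y a f| * (|w u| * |Cf u y z f b|) ≤ (|CM| * Real.exp (-δ * l1 (x - y))) * (|w u| * B) :=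
                mul_le_mul h1 (mul_le_mul_of_nonneg_left (hB u y z f b) (abs_nonneg _)) (by positivity) (by positivity)
            _ = _ := by ring
      _ = ((Fintype.card F : ℝ) * |CM| * B) * Real.exp (-δ * l1 (x - y)) * |w u| := by
          rw [Finset.sum_const, Finset.card_univ, nsmul_eq_mul]; ring
  rw [step1, tsum_comm_of_prodBound hPB]
  refine tsum_congr fun u => ?_
  rw [← tsum_mul_left]
  refine tsum_congr fun y => ?_
  rw [Finset.mul_sum]
  exact Finset.sum_congr rfl fun f _ => by ring

/-- EXCHANGE `(Σ'_u w_u C_u) ∘ 𝕄 = Σ'_u w_u (C_u ∘ 𝕄)`. -/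
theorem wsum_comp {M : MKer D F} {w : (Fin D → ℤ) → ℝ} {Cf : (Fin D → ℤ) → MKer D F} (hM : Spr M)
    (hw : Summable fun u => |w u|) {B : ℝ} (hB0 : 0 ≤ B) (hB : ∀ u x z a b, |Cf u x z a b| ≤ B) :
    comp (wsum w Cf) M = wsum w (fun u => comp (Cf u) M) := by
  have h := comp_wsum (Cf := fun u => trK (Cf u)) hM.trK hw hB0 (fun u x z a b => hB u z x b a)
  have e1 : wsum w (fun u => trK (Cf u)) = trK (wsum w Cf) := by
    funext x z a b; rfl
  rw [e1, ← trK_comp] at h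
  have h' := congrArg trK h
  rw [trK_trK] at h'
  rw [h']
  funext x z a b
  show wsum w (fun u => comp (trK M) (trK (Cf u))) z x b a = ∑' u, w u * comp (Cf u) M x z a b
  show (∑' u, w u * comp (trK M) (trK (Cf u)) z x b a) = ∑' u, w u * comp (Cf u) M x z a b
  refine tsum_congr fun u => ?_
  rw [← trK_comp]
  rfl

omit [Fintype F] in
/-- Additivity of the weighted superposition (absolutely summable weights, bounded families). -/
theorem wsum_add {w : (Fin D → ℤ) → ℝ} {S T : (Fin D → ℤ) → MKer D F} (hw : Summable fun u => |w u|)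
    {B : ℝ} (hS : ∀ u x z a b, |S u x z a b| ≤ B) (hT : ∀ u x z a b, |T u x z a b| ≤ B) :
    wsum w (fun u => S u + T u) = wsum w S + wsum w T := by
  funext x z a b
  have hs : ∀ (R : (Fin D → ℤ) → MKer D F), (∀ u x z a b, |R u x z a b| ≤ B) → Summable fun u => w u * R u x z a b :=
    fun R hR => Summable.of_norm_bounded (hw.mul_right B) (fun u => by
      rw [Real.norm_eq_abs, abs_mul]; exact mul_le_mul_of_nonneg_left (hR u x z a b) (abs_nonneg _))
  show (∑' u, w u * (S u + T u) x z a b) = (∑' u, w u * S u x z a b) + ∑' u, w u * T u x z a b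
  rw [← (hs S hS).tsum_add (hs T hT)]
  exact tsum_congr fun u => by simp only [Pi.add_apply]; ring

omit [Fintype F] in
/-- Subtractivity of the weighted superposition. -/
theorem wsum_sub {w : (Fin D → ℤ) → ℝ} {S T : (Fin D → ℤ) → MKer D F} (hw : Summable fun u => |w u|)
    {B : ℝ} (hS : ∀ u x z a b, |S u x z a b| ≤ B) (hT : ∀ u x z a b, |T u x z a b| ≤ B) :
    wsum w (fun u => S u - T u) = wsum w S - wsum w T := by
  funext x z a b
  have hs : ∀ (R : (Fin D → ℤ) → MKer D F), (∀ u x z a b, |R u x z a b| ≤ B) → Summable fun u => w u * R u x z a b :=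
    fun R hR => Summable.of_norm_bounded (hw.mul_right B) (fun u => by
      rw [Real.norm_eq_abs, abs_mul]; exact mul_le_mul_of_nonneg_left (hR u x z a b) (abs_nonneg _))
  show (∑' u, w u * (S u - T u) x z a b) = (∑' u, w u * S u x z a b) - ∑' u, w u * T u x z a b
  rw [← (hs S hS).tsum_sub (hs T hT)]
  exact tsum_congr fun u => by simp only [Pi.sub_apply]; ring

end General

/-! ## §3 The packed level: the chain-rule vertex of a conjugated stencil family -/

section Packed

variable {d N : ℕ}

/-- A `LocStencil` family is uniformly bounded by its constant. -/
theorem abs_le_of_locStencil {S : Fin (d + 1) → (Fin (d + 1) → ℤ) → MKer (d + 1) (Fib d)} {Cs δ : ℝ} (hS : LocStencil S Cs δ)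
    (hδ : 0 ≤ δ) (κ' : Fin (d + 1)) (u x z : Fin (d + 1) → ℤ) (a b : Fib d) : |S κ' u x z a b| ≤ Cs :=
  bdd_of_biLoc (hS κ' u) hδ x z a b

/-- The `ℋ`-column weights of a decaying packed kernel are absolutely summable. -/
theorem summable_abs_colH {K : MKer (d + 1) (Fib d)} (hK : ∃ δ C : ℝ, 0 < δ ∧ 0 ≤ C ∧ Decays K C δ) (μ : Fin (d + 1))
    (y : Fin (d + 1) → ℤ) (κ' : Fin (d + 1)) : Summable fun u => |colH K N μ y κ' u| := by
  obtain ⟨δ, C, hδ, hC, hK⟩ := hK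
  refine Summable.of_nonneg_of_le (fun u => abs_nonneg _) (fun u => abs_colH_le (N := N) hK μ y κ' u) ?_
  exact (summable_exp_shift' hδ ((N : ℤ) • y)).mul_left C

/-- The chain-rule vertex as a finite sum of weighted superpositions (kernel-valued). -/
theorem vertexOfK_eq_sum (K : MKer (d + 1) (Fib d)) (S : Fin (d + 1) → (Fin (d + 1) → ℤ) → MKer (d + 1) (Fib d))
    (μ : Fin (d + 1)) (y : Fin (d + 1) → ℤ) : vertexOfK K N S μ y = ∑ κ', wsum (colH K N μ y κ') (S κ') := by
  funext x z a b
  simp only [vertexOfK, Finset.sum_apply]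

/-- ADDITIVITY OF THE CHAIN-RULE VERTEX in the stencil family (decaying `K`, bounded families). -/
theorem vertexOfK_add {K : MKer (d + 1) (Fib d)} (hK : ∃ δ C : ℝ, 0 < δ ∧ 0 ≤ C ∧ Decays K C δ)
    {S T : Fin (d + 1) → (Fin (d + 1) → ℤ) → MKer (d + 1) (Fib d)} {B : ℝ} (hS : ∀ κ' u x z a b, |S κ' u x z a b| ≤ B)
    (hT : ∀ κ' u x z a b, |T κ' u x z a b| ≤ B) (μ : Fin (d + 1)) (y : Fin (d + 1) → ℤ) :
    vertexOfK K N (fun κ' u => S κ' u + T κ' u) μ y = vertexOfK K N S μ y + vertexOfK K N T μ y := by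
  rw [vertexOfK_eq_sum, vertexOfK_eq_sum, vertexOfK_eq_sum, ← Finset.sum_add_distrib]
  refine Finset.sum_congr rfl fun κ' _ => ?_
  exact wsum_add (summable_abs_colH (N := N) hK μ y κ') (hS κ') (hT κ')

/-- The chain-rule vertex of the negated family. -/
theorem vertexOfK_neg (K : MKer (d + 1) (Fib d)) (S : Fin (d + 1) → (Fin (d + 1) → ℤ) → MKer (d + 1) (Fib d)) (μ : Fin (d + 1))
    (y : Fin (d + 1) → ℤ) : vertexOfK K N (fun κ' u => -S κ' u) μ y = -vertexOfK K N S μ y := by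
  funext x z a b
  simp only [vertexOfK, OneStepResolventKernel.wsum, Pi.neg_apply, mul_neg, tsum_neg, Finset.sum_neg_distrib]

/-- Transposition commutes with the chain-rule vertex (termwise). -/
theorem trK_vertexOfK (K : MKer (d + 1) (Fib d)) (S : Fin (d + 1) → (Fin (d + 1) → ℤ) → MKer (d + 1) (Fib d)) (μ : Fin (d + 1))
    (y : Fin (d + 1) → ℤ) : trK (vertexOfK K N S μ y) = vertexOfK K N (fun κ' u => trK (S κ' u)) μ y := by
  funext x z a b
  rfl

/-- A weighted superposition of a `LocStencil` family with `ℋ`-column weights is localised. -/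
theorem loc_wsum_colH {K : MKer (d + 1) (Fib d)} (hK : ∃ δ C : ℝ, 0 < δ ∧ 0 ≤ C ∧ Decays K C δ)
    {S : Fin (d + 1) → (Fin (d + 1) → ℤ) → MKer (d + 1) (Fib d)} {Cs δs : ℝ} (hS : LocStencil S Cs δs) (hδs : 0 < δs)
    (μ : Fin (d + 1)) (y : Fin (d + 1) → ℤ) (κ' : Fin (d + 1)) : Loc (wsum (colH K N μ y κ') (S κ')) := by
  obtain ⟨Cv, δv, hδv, hV⟩ := vertexFamily_vertexOfK' (N := N) hK (S := fun κ'' u => if κ'' = κ' then S κ'' u else 0)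
    (Cs := Cs) (δ := δs) (fun κ'' u => by
      by_cases h : κ'' = κ'
      · simp only [h, if_true]; exact hS κ' u
      · intro x z a b
        simp only [h, if_false, Pi.zero_apply, abs_zero]
        exact mul_nonneg ((hS κ' u).nonneg a) (Real.exp_pos _).le) hδs
  refine ⟨(N : ℤ) • y, (N : ℤ) • y, Cv, δv, hδv, ?_⟩
  have e : vertexOfK K N (fun κ'' u => if κ'' = κ' then S κ'' u else 0) μ y = wsum (colH K N μ y κ') (S κ') := by
    rw [vertexOfK_eq_sum, Finset.sum_eq_single κ']
    · simp only [if_true]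
    · intro κ'' _ hne
      funext x z a b
      show (∑' u, colH K N μ y κ'' u * (if κ'' = κ' then S κ'' u else 0) x z a b) = (0 : MKer (d + 1) (Fib d)) x z a b
      simp [hne]
    · intro h; exact absurd (Finset.mem_univ κ') h
  rw [← e]
  exact hV μ y

/-- **THE CHAIN-RULE VERTEX OF A CONJUGATED STENCIL FAMILY IS THE CONJUGATE OF THE CHAIN-RULE VERTEX**:
`vertexOfK K N (κ′ u ↦ conjV 𝕄 (C κ′ u)) μ y = conjV 𝕄 (vertexOfK K N C μ y)` (two exchanges of absolutely convergent sums). -/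
theorem vertexOfK_conjV {K M : MKer (d + 1) (Fib d)} (hK : ∃ δ C : ℝ, 0 < δ ∧ 0 ≤ C ∧ Decays K C δ) (hM : Spr M)
    {Cf : Fin (d + 1) → (Fin (d + 1) → ℤ) → MKer (d + 1) (Fib d)} {Cc δc : ℝ} (hCf : LocStencil Cf Cc δc) (hδc : 0 < δc)
    (μ : Fin (d + 1)) (y : Fin (d + 1) → ℤ) :
    vertexOfK K N (fun κ' u => conjV M (Cf κ' u)) μ y = conjV M (vertexOfK K N Cf μ y) := by
  obtain ⟨CM, δM, hδM, hMd⟩ := id hM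
  have hCc : 0 ≤ Cc := (hCf 0 0).nonneg (Sum.inl 0)
  have hδ : 0 < min δM δc := lt_min hδM hδc
  have hMd' : Decays M (|CM|) (min δM δc) := decays_of_le hMd (min_le_left δM δc)
  -- uniform bounds: `Cf` by `Cc`; `M ∘ Cf u` and `Cf u ∘ M` by the (u-independent) constant of `biLoc_comp_decays`
  have hB₁ : ∀ κ' u x z a b, |Cf κ' u x z a b| ≤ Cc := abs_le_of_locStencil hCf hδc.le
  set B₂ := (Fintype.card (Fib d) : ℝ) * (|CM| * |Cc|) * ExpKernelCalculus.Zl (d + 1) (min δM δc - min δM δc / 2) with hB₂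
  have hMC : ∀ κ' u, BiLoc (comp M (Cf κ' u)) u u B₂ (min δM δc / 2) := fun κ' u =>
    biLoc_comp_decays hMd' (biLoc_of_le (hCf κ' u) (min_le_right δM δc)) (by linarith) (by linarith)
  have hCM : ∀ κ' u, BiLoc (comp (Cf κ' u) M) u u B₂ (min δM δc / 2) := fun κ' u => by
    have h := biLoc_comp_decays (decays_trK hMd') (biLoc_trK (biLoc_of_le (hCf κ' u) (min_le_right δM δc))) (by linarith)
      (show min δM δc / 2 < min δM δc by linarith)
    rw [← trK_comp] at h
    have h' := biLoc_trK h
    rwa [trK_trK] at h'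
  have hbMC : ∀ κ' u x z a b, |comp M (Cf κ' u) x z a b| ≤ B₂ := fun κ' u => bdd_of_biLoc (hMC κ' u) (by linarith)
  have hbCM : ∀ κ' u x z a b, |comp (Cf κ' u) M x z a b| ≤ B₂ := fun κ' u => bdd_of_biLoc (hCM κ' u) (by linarith)
  have hw := summable_abs_colH (N := N) hK μ y
  rw [vertexOfK_eq_sum]
  have e : ∀ κ', wsum (colH K N μ y κ') (fun u => conjV M (Cf κ' u))
      = comp M (wsum (colH K N μ y κ') (Cf κ')) - comp (wsum (colH K N μ y κ') (Cf κ')) M := by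
    intro κ'
    unfold conjV
    rw [wsum_sub (hw κ') (hbMC κ') (hbCM κ'), comp_wsum hM (hw κ') hCc (hB₁ κ'), wsum_comp hM (hw κ') hCc (hB₁ κ')]
  simp only [e]
  rw [Finset.sum_sub_distrib, conjV, vertexOfK_eq_sum,
    comp_finset_sum_right Finset.univ (fun κ' _ => slices_tame hM.tame (loc_wsum_colH (N := N) hK hCf hδc μ y κ').tame),
    comp_finset_sum_left Finset.univ (fun κ' _ => slices_tame (loc_wsum_colH (N := N) hK hCf hδc μ y κ').tame hM.tame)]

/-- `vertexOfK_reflect` WITH AN ARBITRARY FAMILY ON THE RIGHT: if `S κ′ (bref α κ′ u) = ε_κ′ • refK Φ (S′ κ′ u)` then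
`vertexOfK K N S μ (bref α μ y) = ε_μ • refK Φ (vertexOfK K N S′ μ y)` (the tree's proof, verbatim, never uses `S′ = S`). -/
theorem vertexOfK_reflect' {K : MKer (d + 1) (Fib d)} {α : Fin (d + 1)} (hK : refK (Φ N α) K = K)
    {S S' : Fin (d + 1) → (Fin (d + 1) → ℤ) → MKer (d + 1) (Fib d)}
    (hSr : ∀ κ' u, S κ' (bref α κ' u) = reflSign α κ' • refK (Φ N α) (S' κ' u)) (μ : Fin (d + 1)) (y : Fin (d + 1) → ℤ) :
    vertexOfK K N S μ (bref α μ y) = reflSign α μ • refK (Φ N α) (vertexOfK K N S' μ y) := by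
  funext x z a b
  simp only [vertexOfK, OneStepResolventKernel.wsum, Pi.smul_apply, smul_eq_mul, refK_apply]
  have hterm : ∀ κ' : Fin (d + 1), ∑' u, colH K N μ (bref α μ y) κ' u * S κ' u x z a b
      = reflSign α μ * ((Φ N α).s a * (Φ N α).s b) *
          ∑' u, colH K N μ y κ' u * S' κ' u ((Φ N α).r a x) ((Φ N α).r b z) a b := by
    intro κ'
    rw [← Equiv.tsum_eq (Function.Involutive.toPerm (bref α κ') (bref_bref α κ'))]
    simp only [Function.Involutive.coe_toPerm]
    rw [← tsum_mul_left]
    refine tsum_congr fun u => ?_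
    rw [colH_reflect hK, hSr κ' u]
    simp only [Pi.smul_apply, smul_eq_mul, refK_apply]
    have h1 := reflSign_mul_self α κ'
    calc reflSign α κ' * reflSign α μ * colH K N μ y κ' u *
          (reflSign α κ' * ((Φ N α).s a * (Φ N α).s b * S' κ' u ((Φ N α).r a x) ((Φ N α).r b z) a b))
        = (reflSign α κ' * reflSign α κ') * (reflSign α μ * ((Φ N α).s a * (Φ N α).s b) *
            (colH K N μ y κ' u * S' κ' u ((Φ N α).r a x) ((Φ N α).r b z) a b)) := by ring
      _ = _ := by rw [h1, one_mul]
  calc ∑ κ', ∑' u, colH K N μ (bref α μ y) κ' u * S κ' u x z a b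
      = ∑ κ', reflSign α μ * ((Φ N α).s a * (Φ N α).s b) *
          ∑' u, colH K N μ y κ' u * S' κ' u ((Φ N α).r a x) ((Φ N α).r b z) a b := Finset.sum_congr rfl fun κ' _ => hterm κ'
    _ = reflSign α μ * ((Φ N α).s a * (Φ N α).s b *
          ∑ κ', ∑' u, colH K N μ y κ' u * S' κ' u ((Φ N α).r a x) ((Φ N α).r b z) a b) := by
        rw [← Finset.mul_sum]; ring

/-- **THE FINE SOCKET (Sr-conj) GIVES THE COARSE CONJUGATED VERTEX LAW**: for a reflection-invariant decaying packed `K`, spread `𝕄`,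
a local stencil family `S` and a local CONTACT-GENERATOR family `C` with `S κ′ (bref α κ′ u) = ε_κ′ • refK Φ (S κ′ u + conjV 𝕄 (C κ′ u))`,
the chain-rule vertex obeys `V μ (bref α μ y) = ε_μ • refK Φ (V μ y + conjV 𝕄 (vertexOfK K N C μ y))`. -/
theorem vertexOfK_reflect_conj {K M : MKer (d + 1) (Fib d)} {α : Fin (d + 1)} (hKr : refK (Φ N α) K = K)
    (hK : ∃ δ C : ℝ, 0 < δ ∧ 0 ≤ C ∧ Decays K C δ) (hM : Spr M)
    {S C : Fin (d + 1) → (Fin (d + 1) → ℤ) → MKer (d + 1) (Fib d)} {Cs δs Cc δc : ℝ} (hS : LocStencil S Cs δs) (hδs : 0 < δs)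
    (hC : LocStencil C Cc δc) (hδc : 0 < δc)
    (hSrC : ∀ κ' u, S κ' (bref α κ' u) = reflSign α κ' • refK (Φ N α) (S κ' u + conjV M (C κ' u)))
    (μ : Fin (d + 1)) (y : Fin (d + 1) → ℤ) :
    vertexOfK K N S μ (bref α μ y) = reflSign α μ • refK (Φ N α) (vertexOfK K N S μ y + conjV M (vertexOfK K N C μ y)) := by
  obtain ⟨CM, δM, hδM, hMd⟩ := id hM
  -- a common uniform bound for `S κ′ u` and `conjV 𝕄 (C κ′ u)`
  have hδ : 0 < min δM δc := lt_min hδM hδc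
  have hMd' : Decays M (|CM|) (min δM δc) := decays_of_le hMd (min_le_left δM δc)
  set B₂ := (Fintype.card (Fib d) : ℝ) * (|CM| * |Cc|) * ExpKernelCalculus.Zl (d + 1) (min δM δc - min δM δc / 2) with hB₂
  have hbMC : ∀ κ' u x z a b, |comp M (C κ' u) x z a b| ≤ B₂ := fun κ' u =>
    bdd_of_biLoc (biLoc_comp_decays hMd' (biLoc_of_le (hC κ' u) (min_le_right δM δc)) (by linarith)
      (show min δM δc / 2 < min δM δc by linarith)) (by linarith)
  have hbCM : ∀ κ' u x z a b, |comp (C κ' u) M x z a b| ≤ B₂ := fun κ' u => by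
    have h := biLoc_comp_decays (decays_trK hMd') (biLoc_trK (biLoc_of_le (hC κ' u) (min_le_right δM δc))) (by linarith)
      (show min δM δc / 2 < min δM δc by linarith)
    rw [← trK_comp] at h
    have h' := biLoc_trK h
    rw [trK_trK] at h'
    exact bdd_of_biLoc h' (by linarith)
  have hBS : ∀ κ' u x z a b, |S κ' u x z a b| ≤ max Cs (B₂ + B₂) := fun κ' u x z a b =>
    (abs_le_of_locStencil hS hδs.le κ' u x z a b).trans (le_max_left _ _)
  have hBT : ∀ κ' u x z a b, |conjV M (C κ' u) x z a b| ≤ max Cs (B₂ + B₂) := fun κ' u x z a b => by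
    refine le_trans ?_ (le_max_right _ _)
    unfold conjV
    rw [Pi.sub_apply, Pi.sub_apply, Pi.sub_apply, Pi.sub_apply]
    exact (abs_sub _ _).trans (add_le_add (hbMC κ' u x z a b) (hbCM κ' u x z a b))
  rw [vertexOfK_reflect' hKr hSrC μ y, vertexOfK_add hK hBS hBT, vertexOfK_conjV hK hM hC hδc]

end Packed

end

end Summit.QuantumFields.BalabanUV.Beta.ChartConjugationReflection
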